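import Summits.ABC.ABC.Theses.TwistAmplification

/-!
# Ideator-2 sketch for crux `ModerateWindowCount` (stmt-ABC-1973), round 1 — restored in generation 2

The two crux idea cards filed by this ideator slot
(`Cruxes/ModerateWindowCount/Ideas/kappa-six-near-violators.md`,
`Cruxes/ModerateWindowCount/Ideas/commutator-curve-twist-occupancy.md`) quote the declarations below as their
`First lemma:` fields.  The generation-1 folder (and its `Sketch.lean`) is gone; this file re-creates the quoted
declarations verbatim so that triage can check them: the glue theorems are proved, everything else is a
`def … : Prop` (statements only, no `sorry`).
-/

set_option linter.dupNamespace false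

namespace Summit.ABC.ABC.Cruxes.ModerateWindowCount.Ideator2

open Summit.ABC.ABC.Theses.TwistAmplification IsDedekindDomain WeierstrassCurve

noncomputable section

/-! ## Card `kappa-six-near-violators` -/

/-- Near-Violator Sparsity: for every `σ > 6` the reduced minimal models with `c₄ c₆ ≠ 0`, conductor `N ≤ X`
and generalized Szpiro size `N⁶ ≤ M⁺ ≤ N^σ` number `≤ C·X^δ` for some `δ < (σ−6)/(2σ−6)`.  This is the crux
with the existential witness `κ := 6`. -/
def NearViolatorSparsity : Prop :=
  ∀ σ : ℝ, 6 < σ → ∃ δ C : ℝ, δ < (σ - 6) / (2 * σ - 6) ∧ ∀ X : ℝ, 1 ≤ X →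
    (Set.ncard {W₀ : WeierstrassCurve ℤ | (W₀.baseChange ℚ).IsElliptic ∧
      (∀ v : HeightOneSpectrum ℤ, (W₀.baseChange ℚ).IsMinimalAt v) ∧
      (W₀.a₁ = 0 ∨ W₀.a₁ = 1) ∧ (W₀.a₃ = 0 ∨ W₀.a₃ = 1) ∧ (W₀.a₂ = -1 ∨ W₀.a₂ = 0 ∨ W₀.a₂ = 1) ∧
      W₀.c₄ ≠ 0 ∧ W₀.c₆ ≠ 0 ∧ (((W₀.baseChange ℚ).conductorNorm ℤ : ℕ) : ℝ) ≤ X ∧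
      (((W₀.baseChange ℚ).conductorNorm ℤ : ℕ) : ℝ) ^ (6 : ℝ) ≤ ((max |W₀.Δ| (|W₀.c₄| ^ 3) : ℤ) : ℝ) ∧
      ((max |W₀.Δ| (|W₀.c₄| ^ 3) : ℤ) : ℝ) ≤ (((W₀.baseChange ℚ).conductorNorm ℤ : ℕ) : ℝ) ^ σ} : ℝ) ≤ C * X ^ δ

/-- The witness `κ := 6` turns Near-Violator Sparsity into the crux. -/
theorem nearViolatorSparsity_imp (h : NearViolatorSparsity) : ModerateWindowCount := by
  intro σ hσ
  obtain ⟨δ, C, hδ, hB⟩ := h σ hσ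
  exact ⟨6, δ, C, by norm_num, by linarith, hδ, hB⟩

/-- The margin identity: threshold minus law `= (κ−3)(σ−6)/(3(2σ−6))`. -/
theorem margin_identity (κ σ : ℝ) (hσ : 6 < σ) :
    (σ - κ) / (2 * σ - 6) - (1 - κ / 6) = (κ - 3) * (σ - 6) / (3 * (2 * σ - 6)) := by
  have h : 2 * σ - 6 ≠ 0 := by
    have : (0 : ℝ) < 2 * σ - 6 := by linarith
    exact ne_of_gt this
  have hinv : (2 * σ - 6) * (2 * σ - 6)⁻¹ = 1 := mul_inv_cancel₀ h
  rw [show (κ - 3) * (σ - 6) / (3 * (2 * σ - 6)) = (κ - 3) * (σ - 6) / 3 / (2 * σ - 6) by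
    rw [div_div]]
  linear_combination ((3 - κ / 2) / 3) * hinv

/-- The room at witness `κ` (threshold minus the conjectural law `1 − κ/6`, for `κ ≤ 6`) is maximal at
`κ = 6`: for `3 < κ ≤ 6 < σ` it is at most the room at `6`, namely `(σ−6)/(2σ−6)`. -/
theorem room_le_room_at_six (κ σ : ℝ) (_hκ : 3 < κ) (hκ6 : κ ≤ 6) (hσ : 6 < σ) :
    (σ - κ) / (2 * σ - 6) - (1 - κ / 6) ≤ (σ - 6) / (2 * σ - 6) := by
  rw [margin_identity κ σ hσ]
  have hpos : (0 : ℝ) < 2 * σ - 6 := by linarith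
  have h3pos : (0 : ℝ) < 3 * (2 * σ - 6) := by linarith
  rw [div_le_div_iff₀ h3pos hpos]
  nlinarith [mul_pos (by linarith : (0:ℝ) < σ - 6) hpos]

/-- Above `6` the room only shrinks: for `6 ≤ κ < σ` the threshold `(σ−κ)/(2σ−6)` is at most `(σ−6)/(2σ−6)`. -/
theorem threshold_le_threshold_at_six (κ σ : ℝ) (hκ6 : 6 ≤ κ) (hσ : 6 < σ) :
    (σ - κ) / (2 * σ - 6) ≤ (σ - 6) / (2 * σ - 6) := by
  have hpos : (0 : ℝ) < 2 * σ - 6 := by linarith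
  exact div_le_div_of_nonneg_right (by linarith) hpos.le

/-! ## Card `commutator-curve-twist-occupancy` -/

open Classical in
/-- `D₆⁰(W₀)`: the product of the primes `p ≥ 5` of multiplicative type (`p ∤ c₄`, `p ∣ Δ`) whose discriminant
exponent is a positive multiple of `6`. -/
def sexticRadical (W₀ : WeierstrassCurve ℤ) : ℕ :=
  ∏ p ∈ (W₀.Δ.natAbs.primeFactors.filter
      (fun p : ℕ => 5 ≤ p ∧ ¬ ((p : ℤ) ∣ W₀.c₄) ∧ 6 ∣ padicValInt p W₀.Δ)), p

/-- (L0′) Small-point multiplicity on the Mordell curves `𝓜_u : y² = x³ − u`: the rational points with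
`H(x) ≤ T` number `≪ (|u|+2)^ε T^ε`. -/
def SmallPointMultiplicity : Prop :=
  ∀ ε : ℝ, 0 < ε → ∃ C : ℝ, ∀ u : ℤ, u ≠ 0 → ∀ T : ℝ, 1 ≤ T →
    (Set.ncard {P : ℚ × ℚ | P.2 ^ 2 = P.1 ^ 3 - (u : ℚ) ∧
        max (|(P.1.num : ℝ)|) (P.1.den : ℝ) ≤ T} : ℝ) ≤ C * (((|u| : ℤ) : ℝ) + 2) ^ ε * T ^ ε

/-- The SHARP SLICE: window-type curves (conductor `≤ X`, `M⁺ ≤ N^σ`) whose sextic radical `D₆⁰` carries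
`≥ N^{1−θ}` number `≪ X^{θ+ε}`. -/
def SexticDominantSparse : Prop :=
  ∀ θ σ ε : ℝ, 0 < θ → θ ≤ 1 → 0 < ε → ∃ C : ℝ, ∀ X : ℝ, 1 ≤ X →
    (Set.ncard {W₀ : WeierstrassCurve ℤ | (W₀.baseChange ℚ).IsElliptic ∧
      (∀ v : HeightOneSpectrum ℤ, (W₀.baseChange ℚ).IsMinimalAt v) ∧
      (W₀.a₁ = 0 ∨ W₀.a₁ = 1) ∧ (W₀.a₃ = 0 ∨ W₀.a₃ = 1) ∧ (W₀.a₂ = -1 ∨ W₀.a₂ = 0 ∨ W₀.a₂ = 1) ∧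
      W₀.c₄ ≠ 0 ∧ W₀.c₆ ≠ 0 ∧ (((W₀.baseChange ℚ).conductorNorm ℤ : ℕ) : ℝ) ≤ X ∧
      ((max |W₀.Δ| (|W₀.c₄| ^ 3) : ℤ) : ℝ) ≤ (((W₀.baseChange ℚ).conductorNorm ℤ : ℕ) : ℝ) ^ σ ∧
      (((W₀.baseChange ℚ).conductorNorm ℤ : ℕ) : ℝ) ^ (1 - θ) ≤ ((sexticRadical W₀ : ℕ) : ℝ)} : ℝ)
      ≤ C * X ^ (θ + ε)

/-- First lemma of the commutator-curve line (statement): small-point multiplicity gives the sharp slice. -/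
def FirstLemmaA : Prop := SmallPointMultiplicity → SexticDominantSparse

end

end Summit.ABC.ABC.Cruxes.ModerateWindowCount.Ideator2
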